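import Mathlib
import Literature.AlgebraicGeometry.Resolution.WeightedQuasiRegularIndexed
import HarnessLib

/-!
# Weighted initial terms and the Newton point set of an ideal, expansion-free — ARBITRARY dimension

Topic: `Literature/AlgebraicGeometry/Resolution`. Dimension-general form of `WeightedInitialTerms.lean` (`c : Fin 3 → R`), third brick of
the generalisation `Fin 3 → Fin (r+2)` of the tree's expansion-free rendering of Hironaka's characteristic polyhedra needed by
Cossart–Jannsen–Saito's key theorem 6.40 in arbitrary embedding dimension (memo
`run/shared/lean/pub/res-hironaka/L/res-L1-w42-stub-3/KEYCLAIM-PORT-PLAN.md` §4). Source and rendering exactly as in the `Fin 3` file: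
V. Cossart, U. Jannsen, S. Saito, LNM **2270** (2020) [`CossartJannsenSaito2020`], Ch. 7 (7.3)/(7.4) (presentations
`f = Σ C_{A,B} y^B u^A`, `C_{A,B} ∈ R^× ∪ {0}`), Def. 8.2 («`Δ(g, y, u)` does not depend on the presentation»), Lemma 8.3, Remark 8.9 (2)
(«`Δ(f, y, u)` is defined by equations `L₁(A) ≥ d₁, …, L_t(A) ≥ d_t`»); Cossart–Piltant 2008 §4 p. 10 (the exponent set `E`); Hironaka 1967 §1.
We replace presentations by

* **unit representatives** (`WeightedOrder.exists_unitRep`): every `f ∈ R` is, modulo `𝔪^N`, a polynomial `F(c)` with UNIT coefficients;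
* **weighted quasi-regularity** (`coeff_mem_maximalIdeal_of_weval_mem_weightedOrderIdeal`, previous file), making the lowest-weight part of a
  unit representative canonical: `WeightedOrder.mem_weightedOrderIdeal_iff_of_unitRep`;
* **initial unit terms** `WeightedOrder.IsInitialTerm c w f e` (`f ≡ F(c) mod F^{(w)}_{⟨w,e⟩+1}`, `F` `w`-homogeneous of weight `⟨w,e⟩`,
  `coeff_e F` a unit) — canonical (`isInitialTerm_iff_of_unitRep`) — and the **Newton point set** `WeightedOrder.occ c J`;
* ★ `WeightedOrder.le_weightedOrderIdeal_iff_forall_occ`: for positive weights `w`, `J ⊆ F^{(w)}_ρ ⟺ ∀ e ∈ occ c J, ρ ≤ ⟨w, e⟩`.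

Statements and proofs are those of the `Fin 3` file verbatim with `Fin 3 ↦ σ` (definitions, unit representatives) / `Fin 3 ↦ Fin (n+1)`
(the regular part), `monom3 ↦ cmonom`, `weightedIdealW ↦ weightedOrderIdeal`; the sub-namespace `WeightedOrder` keeps the names apart
from the `Fin 3` ones. No named facts; no instance, notation or attribute; nothing about schemes.
-/

noncomputable section

open IsLocalRing MvPolynomial

namespace Literature.AlgebraicGeometry.Resolution

namespace WeightedOrder

universe u v

variable {R : Type u} [CommRing R] {σ : Type v}

/-! ## Unit representatives (CJS (7.3), truncated) -/


/-- A polynomial all of whose (nonzero) coefficients are units. [cite: CossartJannsenSaito2020, Ch. 7 (7.3)] -/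
def HasUnitCoeffs (F : MvPolynomial σ R) : Prop := ∀ m ∈ F.support, IsUnit (F.coeff m)

/-- `0` has unit coefficients (vacuously). [cite: CossartJannsenSaito2020, Ch. 7 (7.3)] -/
theorem hasUnitCoeffs_zero : HasUnitCoeffs (0 : MvPolynomial σ R) := by
  intro m hm; simp at hm

/-- A weighted homogeneous component of a polynomial with unit coefficients has unit
coefficients. [cite: CossartJannsenSaito2020, Ch. 7 (7.3)] -/
theorem HasUnitCoeffs.weightedHomogeneousComponent {F : MvPolynomial σ R}
    (hF : HasUnitCoeffs F) (w : σ → ℕ) (n : ℕ) :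
    HasUnitCoeffs (weightedHomogeneousComponent w n F) := by
  classical
  intro m hm
  rw [mem_support_iff, coeff_weightedHomogeneousComponent] at hm
  rw [coeff_weightedHomogeneousComponent]
  split_ifs with h
  · rw [if_pos h] at hm
    exact hF m (mem_support_iff.mpr hm)
  · rw [if_neg h] at hm; exact absurd rfl hm

/-- **Unit representatives**: every `f ∈ R` is congruent modulo `𝔪^N` to `F(c)` for a polynomial
`F` with unit coefficients supported in degrees `< N`. [cite: CossartJannsenSaito2020, Ch. 7 (7.3)] -/
theorem exists_unitRep [IsLocalRing R] (c : σ → R)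
    (hgen : Ideal.span (Set.range c) = maximalIdeal R) (f : R) (N : ℕ) :
    ∃ F : MvPolynomial σ R, HasUnitCoeffs F ∧ (∀ m ∈ F.support, m.degree < N) ∧
      f - eval c F ∈ maximalIdeal R ^ N := by
  classical
  induction N with
  | zero => exact ⟨0, hasUnitCoeffs_zero, by simp, by simp⟩
  | succ N ih =>
    obtain ⟨F, hFu, hFdeg, hFrem⟩ := ih
    set r := f - eval c F with hr
    have hr1 : r ∈ weightedOrderIdeal c (fun _ => 1) N := by
      rw [weightedOrderIdeal_one_eq_pow c hgen]; exact hFrem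
    obtain ⟨P, hP, hPr⟩ := (mem_weightedOrderIdeal_iff_exists_mvPolynomial c _ N r).mp hr1
    set PN := weightedHomogeneousComponent (fun _ : σ => (1 : ℕ)) N P with hPN
    -- the unit part of `PN`
    set U : MvPolynomial σ R :=
      ∑ m ∈ PN.support.filter (fun m => IsUnit (PN.coeff m)), monomial m (PN.coeff m) with hU
    have hUcoeff : ∀ m, U.coeff m = if m ∈ PN.support ∧ IsUnit (PN.coeff m) then PN.coeff m
        else 0 := by
      intro m
      rw [hU, coeff_sum]
      split_ifs with h
      · rw [Finset.sum_eq_single m]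
        · rw [coeff_monomial, if_pos rfl]
        · intro m' _ hne; rw [coeff_monomial, if_neg hne]
        · intro hm; exact absurd (Finset.mem_filter.mpr h) hm
      · refine Finset.sum_eq_zero fun m' hm' => ?_
        rw [coeff_monomial, if_neg]
        rintro rfl
        exact h (Finset.mem_filter.mp hm')
    have hUsupp : ∀ m ∈ U.support, m ∈ PN.support ∧ IsUnit (PN.coeff m) := by
      intro m hm
      rw [mem_support_iff, hUcoeff] at hm
      by_contra h
      rw [if_neg h] at hm
      exact hm rfl
    have hPNdeg : ∀ m ∈ PN.support, m.degree = N := by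
      intro m hm
      have := weightedHomogeneousComponent_isWeightedHomogeneous N P (mem_support_iff.mp hm)
      rw [← this, Finsupp.degree_eq_weight_one]
    have hFdeg' : ∀ m ∈ F.support, m.degree ≠ N := fun m hm => (hFdeg m hm).ne
    -- new representative
    refine ⟨F + U, ?_, ?_, ?_⟩
    · intro m hm
      rw [coeff_add]
      by_cases hmU : m ∈ U.support
      · obtain ⟨hmPN, hunit⟩ := hUsupp m hmU
        have hmF : F.coeff m = 0 := by
          by_contra h
          exact hFdeg' m (mem_support_iff.mpr h) (hPNdeg m hmPN)
        rw [hmF, zero_add, hUcoeff, if_pos ⟨hmPN, hunit⟩]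
        exact hunit
      · rw [notMem_support_iff.mp hmU, add_zero]
        have hmF : m ∈ F.support := by
          rcases Finset.mem_union.mp (support_add hm) with h | h
          · exact h
          · exact absurd h hmU
        exact hFu m hmF
    · intro m hm
      rcases Finset.mem_union.mp (support_add hm) with h | h
      · exact (hFdeg m h).trans (Nat.lt_succ_self N)
      · rw [hPNdeg m (hUsupp m h).1]; exact Nat.lt_succ_self N
    · -- `f - (F + U)(c) = (P - PN)(c) + (PN - U)(c)`
      have hsplit : f - eval c (F + U) = eval c (P - PN) + eval c (PN - U) := by
        rw [map_add, map_sub, map_sub, hPr, hr]; ring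
      rw [hsplit]
      refine Ideal.add_mem _ ?_ ?_
      · -- higher-degree part
        rw [← weightedOrderIdeal_one_eq_pow c hgen]
        refine (mem_weightedOrderIdeal_iff_exists_mvPolynomial c _ (N + 1) _).mpr
          ⟨P - PN, fun m hm => ?_, rfl⟩
        rw [mem_support_iff, coeff_sub, hPN, coeff_weightedHomogeneousComponent] at hm
        by_cases hwt : Finsupp.weight (fun _ : σ => (1 : ℕ)) m = N
        · rw [if_pos hwt, sub_self] at hm; exact absurd rfl hm
        · rw [if_neg hwt, sub_zero] at hm
          have := hP m (mem_support_iff.mpr hm)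
          omega
      · -- the non-unit coefficients of `PN` lie in `𝔪`
        have hci : ∀ i, c i ∈ maximalIdeal R := fun i => by
          rw [← hgen]; exact Ideal.subset_span ⟨i, rfl⟩
        rw [(PN - U).as_sum, map_sum]
        refine Ideal.sum_mem _ fun m hm => ?_
        rw [eval_monomial_eq_cmonom, coeff_sub]
        have hmPN : m ∈ PN.support := by
          rcases Finset.mem_union.mp (support_sub _ PN U hm) with h | h
          · exact h
          · exact (hUsupp m h).1
        by_cases hunit : IsUnit (PN.coeff m)
        · rw [hUcoeff, if_pos ⟨hmPN, hunit⟩, sub_self, zero_mul]; exact Ideal.zero_mem _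
        · rw [hUcoeff, if_neg (fun h => hunit h.2), sub_zero]
          have hcm : PN.coeff m ∈ maximalIdeal R := (mem_maximalIdeal _).mpr hunit
          have hmono : cmonom c m ∈ maximalIdeal R ^ N := by
            have hmem := cmonom_mem_pow_degree c (maximalIdeal R) hci m
            rwa [hPNdeg m hmPN] at hmem
          rw [pow_succ, mul_comm (maximalIdeal R ^ N)]
          exact Ideal.mul_mem_mul hcm hmono

/-- Unit representatives modulo a weighted order ideal: for positive weights, every `f` is
congruent modulo `F^{(w)}_M` to `F(c)` with `F` of unit coefficients. [cite: CossartJannsenSaito2020, Ch. 7 (7.3)] -/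
theorem exists_unitRep_weighted [IsLocalRing R] (c : σ → R)
    (hgen : Ideal.span (Set.range c) = maximalIdeal R) {w : σ → ℕ} (hw : ∀ i, 0 < w i)
    (f : R) (M : ℕ) :
    ∃ F : MvPolynomial σ R, HasUnitCoeffs F ∧ (∀ m ∈ F.support, m.degree < M) ∧
      f - eval c F ∈ weightedOrderIdeal c w M := by
  obtain ⟨F, hFu, hFdeg, hFrem⟩ := exists_unitRep c hgen f M
  exact ⟨F, hFu, hFdeg, pow_maximalIdeal_le_weightedOrderIdeal c _ hw hgen M hFrem⟩

/-! ## Initial unit terms and Newton points: definitions -/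

/-! ## Initial unit terms and Newton points: definitions -/

/-- The evaluation of a polynomial all of whose monomials have weight `≥ ρ` lies in `F_ρ`.
[cite: CossartJannsenSaito2020, Ch. 7 (7.3)] -/
theorem eval_mem_weightedOrderIdeal_of_forall_le (c : σ → R) (w : σ → ℕ) {ρ : ℕ}
    {F : MvPolynomial σ R} (hF : ∀ m ∈ F.support, ρ ≤ Finsupp.weight w m) :
    eval c F ∈ weightedOrderIdeal c w ρ :=
  (mem_weightedOrderIdeal_iff_exists_mvPolynomial c w ρ _).mpr ⟨F, hF, rfl⟩

/-- The part of `F` of weight `≠ n` above the minimum weight `n` of `F` evaluates into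
`F_{n+1}`. [cite: CossartJannsenSaito2020, Ch. 7 (7.3)] -/
theorem eval_sub_component_mem (c : σ → R) (w : σ → ℕ) {n : ℕ}
    {F : MvPolynomial σ R} (hmin : ∀ m ∈ F.support, n ≤ Finsupp.weight w m) :
    eval c (F - weightedHomogeneousComponent w n F) ∈ weightedOrderIdeal c w (n + 1) := by
  classical
  refine eval_mem_weightedOrderIdeal_of_forall_le c w fun m hm => ?_
  rw [mem_support_iff, coeff_sub, coeff_weightedHomogeneousComponent] at hm
  by_cases hwt : Finsupp.weight w m = n
  · rw [if_pos hwt, sub_self] at hm; exact absurd rfl hm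
  · rw [if_neg hwt, sub_zero] at hm
    have := hmin m (mem_support_iff.mpr hm)
    omega

/-- The difference of two `w`-homogeneous polynomials of the same weight is `w`-homogeneous.
[cite: CossartJannsenSaito2020, Ch. 7 (7.3)] -/
theorem isWeightedHomogeneous_sub {w : σ → ℕ} {n : ℕ} {F G : MvPolynomial σ R}
    (hF : F.IsWeightedHomogeneous w n) (hG : G.IsWeightedHomogeneous w n) :
    (F - G).IsWeightedHomogeneous w n := by
  intro d hd
  rw [coeff_sub] at hd
  by_cases hFd : F.coeff d = 0
  · have hGd : G.coeff d ≠ 0 := by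
      intro h; rw [hFd, h, sub_zero] at hd; exact hd rfl
    exact hG hGd
  · exact hF hFd

/-- **`e` is a `w`-initial unit term of `f`**: `f ≡ F(c) mod F^{(w)}_{⟨w,e⟩+1}` for some
`w`-homogeneous `F` of weight `⟨w, e⟩` whose coefficient at `e` is a unit — the expansion-free
form of "`C_{A,B} ≠ 0` and `L(A,B)` minimal" for the term `y^B u^A` of a presentation (7.3)
(CJS Definition 8.2 (2), the `v`-initial `in_v(g)`). [cite: CossartJannsenSaito2020, Def. 8.2] -/
def IsInitialTerm (c : σ → R) (w : σ → ℕ) (f : R) (e : σ →₀ ℕ) : Prop :=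
  ∃ F : MvPolynomial σ R, F.IsWeightedHomogeneous w (Finsupp.weight w e) ∧
    IsUnit (F.coeff e) ∧ f - eval c F ∈ weightedOrderIdeal c w (Finsupp.weight w e + 1)

/-- An element with an initial term of weight `n` lies in `F_n`. [cite: CossartJannsenSaito2020, Ch. 7 (7.3)] -/
theorem IsInitialTerm.mem (c : σ → R) {w : σ → ℕ} {f : R} {e : σ →₀ ℕ}
    (h : IsInitialTerm c w f e) : f ∈ weightedOrderIdeal c w (Finsupp.weight w e) := by
  obtain ⟨F, hF, -, hrem⟩ := h
  have h1 : eval c F ∈ weightedOrderIdeal c w (Finsupp.weight w e) :=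
    eval_mem_weightedOrderIdeal_of_forall_le c w fun m hm => (hF (mem_support_iff.mp hm)).ge
  have h2 := weightedOrderIdeal_antitone c w (Nat.le_succ _) hrem
  have : f = f - eval c F + eval c F := by ring
  rw [this]; exact Ideal.add_mem _ h2 h1

/-- **The Newton point set** of `J` with respect to `c`: the exponents which are `w`-initial unit
terms of some element of `J` for some positive weight `w` (the essential points `Ṽ(f, y, u)` of
CJS Definition 8.5 (4), for all elements of `J` at once; Cossart–Piltant's set `E`, before
normalising by `μ − |B|`). [cite: CossartJannsenSaito2020, Def. 8.5 (4)] [cite: CossartPiltant2008, §4 p. 10] -/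
def occ (c : σ → R) (J : Ideal R) : Set (σ →₀ ℕ) :=
  {e | ∃ f ∈ J, ∃ w : σ → ℕ, (∀ i, 0 < w i) ∧ IsInitialTerm c w f e}

/-- `occ` is monotone in the ideal. [cite: CossartJannsenSaito2020, Ch. 7 (7.3)] -/
theorem occ_mono (c : σ → R) {J J' : Ideal R} (h : J ≤ J') : occ c J ⊆ occ c J' := by
  rintro e ⟨f, hf, w, hw, he⟩; exact ⟨f, h hf, w, hw, he⟩

/-- Initial terms of members are Newton points. [cite: CossartJannsenSaito2020, Ch. 7 (7.3)] -/
theorem mem_occ_of_isInitialTerm (c : σ → R) {J : Ideal R} {f : R} (hf : f ∈ J)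
    {w : σ → ℕ} (hw : ∀ i, 0 < w i) {e : σ →₀ ℕ} (he : IsInitialTerm c w f e) :
    e ∈ occ c J :=
  ⟨f, hf, w, hw, he⟩

/-- Initial terms of generators are Newton points of the generated ideal. [cite: CossartJannsenSaito2020, Ch. 7 (7.3)] -/
theorem mem_occ_span_of_isInitialTerm (c : σ → R) {S : Set R} {f : R} (hf : f ∈ S)
    {w : σ → ℕ} (hw : ∀ i, 0 < w i) {e : σ →₀ ℕ} (he : IsInitialTerm c w f e) :
    e ∈ occ c (Ideal.span S) :=
  ⟨f, Ideal.subset_span hf, w, hw, he⟩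

/-! ## Reading weighted orders off a unit representative -/

section Regular

variable [IsRegularLocalRing R] {d : ℕ} (c : Fin (d + 1) → R)
  (hgen : Ideal.span (Set.range c) = maximalIdeal R) (hdim : ringKrullDim R = d + 1)

include hgen hdim in
/-- **Weighted quasi-regularity, unit form**: a `w`-homogeneous polynomial of weight `n` with a
UNIT coefficient does not evaluate into `F^{(w)}_{n+1}` (positive weights).
[cite: CossartJannsenSaito2020, Lemma 8.3 (1)] [cite: Hironaka1967, §1] -/
theorem eval_not_mem_of_isUnit_coeff {w : Fin (d + 1) → ℕ} (hw : ∀ i, 0 < w i) {n : ℕ}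
    {F : MvPolynomial (Fin (d + 1)) R} (hF : F.IsWeightedHomogeneous w n) {e : Fin (d + 1) →₀ ℕ}
    (he : IsUnit (F.coeff e)) : eval c F ∉ weightedOrderIdeal c w (n + 1) := by
  intro h
  have hsupp : ∀ m ∈ F.support, Finsupp.weight w m = n := fun m hm =>
    hF (mem_support_iff.mp hm)
  have hc := coeff_mem_maximalIdeal_of_weval_mem_weightedOrderIdeal c hgen hdim w hw hsupp h e
  exact (mem_maximalIdeal _).mp hc he

include hgen hdim in
/-- **Membership in the weighted order ideals is read off any unit representative**: if
`f ≡ F(c) mod F_M` with `F` of unit coefficients, then for `ρ ≤ M`,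
`f ∈ F_ρ ⟺ every monomial of F has weight ≥ ρ` (positive weights).
[cite: CossartJannsenSaito2020, Lemma 8.3 (1)] -/
theorem mem_weightedOrderIdeal_iff_of_unitRep {w : Fin (d + 1) → ℕ} (hw : ∀ i, 0 < w i) {f : R}
    {F : MvPolynomial (Fin (d + 1)) R} (hFu : HasUnitCoeffs F) {M : ℕ}
    (hrem : f - eval c F ∈ weightedOrderIdeal c w M) {ρ : ℕ} (hρ : ρ ≤ M) :
    f ∈ weightedOrderIdeal c w ρ ↔ ∀ m ∈ F.support, ρ ≤ Finsupp.weight w m := by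
  classical
  constructor
  · intro hf
    by_contra hne
    push Not at hne
    -- the minimal weight `n` over the support is `< ρ`
    have hsne : F.support.Nonempty := by
      obtain ⟨m, hm, -⟩ := hne; exact ⟨m, hm⟩
    set n := (F.support.image (Finsupp.weight w)).min' (hsne.image _) with hn
    have hnle : ∀ m ∈ F.support, n ≤ Finsupp.weight w m := fun m hm =>
      Finset.min'_le _ _ (Finset.mem_image_of_mem _ hm)
    obtain ⟨m₀, hm₀, hm₀n⟩ : ∃ m₀ ∈ F.support, Finsupp.weight w m₀ = n := by
      have := Finset.min'_mem _ (hsne.image (Finsupp.weight w))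
      obtain ⟨m₀, hm₀, h⟩ := Finset.mem_image.mp this
      exact ⟨m₀, hm₀, h⟩
    have hnρ : n < ρ := by
      obtain ⟨m, hm, hlt⟩ := hne
      exact (hnle m hm).trans_lt hlt
    set F₀ := weightedHomogeneousComponent w n F with hF₀
    have hF₀hom : F₀.IsWeightedHomogeneous w n := weightedHomogeneousComponent_isWeightedHomogeneous n F
    have hF₀e : IsUnit (F₀.coeff m₀) := by
      rw [hF₀, coeff_weightedHomogeneousComponent, if_pos hm₀n]; exact hFu m₀ hm₀
    -- `F₀(c) = f - (f - F(c)) - (F - F₀)(c) ∈ F_{n+1}`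
    have hmem : eval c F₀ ∈ weightedOrderIdeal c w (n + 1) := by
      have h1 : f ∈ weightedOrderIdeal c w (n + 1) := weightedOrderIdeal_antitone c w hnρ hf
      have h2 : f - eval c F ∈ weightedOrderIdeal c w (n + 1) :=
        weightedOrderIdeal_antitone c w (by omega) hrem
      have h3 := eval_sub_component_mem c w hnle
      have : eval c F₀ = f - (f - eval c F) - eval c (F - F₀) := by rw [map_sub]; ring
      rw [this]
      exact Ideal.sub_mem _ (Ideal.sub_mem _ h1 h2) h3
    exact eval_not_mem_of_isUnit_coeff c hgen hdim hw hF₀hom hF₀e hmem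
  · intro hall
    have h1 : eval c F ∈ weightedOrderIdeal c w ρ := eval_mem_weightedOrderIdeal_of_forall_le c w hall
    have h2 : f - eval c F ∈ weightedOrderIdeal c w ρ := weightedOrderIdeal_antitone c w hρ hrem
    have : f = f - eval c F + eval c F := by ring
    rw [this]
    exact Ideal.add_mem _ h2 h1

include hgen hdim in
/-- An element with an initial term of weight `n` does not lie in `F_{n+1}` (positive
weights). [cite: CossartJannsenSaito2020, Lemma 8.3] -/
theorem IsInitialTerm.not_mem_succ {w : Fin (d + 1) → ℕ} (hw : ∀ i, 0 < w i) {f : R}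
    {e : Fin (d + 1) →₀ ℕ} (h : IsInitialTerm c w f e) :
    f ∉ weightedOrderIdeal c w (Finsupp.weight w e + 1) := by
  obtain ⟨F, hF, he, hrem⟩ := h
  intro hf
  have : eval c F = f - (f - eval c F) := by ring
  refine eval_not_mem_of_isUnit_coeff c hgen hdim hw hF he ?_
  rw [this]; exact Ideal.sub_mem _ hf hrem

include hgen hdim in
/-- **Initial terms are canonical**: if `f ≡ F(c) mod F_M` with `F` of unit coefficients and
`⟨w, e⟩ < M`, then `e` is a `w`-initial unit term of `f` iff `e` is a monomial of `F` of minimal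
weight (positive weights). [cite: CossartJannsenSaito2020, Lemma 8.3 (1)] -/
theorem isInitialTerm_iff_of_unitRep {w : Fin (d + 1) → ℕ} (hw : ∀ i, 0 < w i) {f : R}
    {F : MvPolynomial (Fin (d + 1)) R} (hFu : HasUnitCoeffs F) {M : ℕ}
    (hrem : f - eval c F ∈ weightedOrderIdeal c w M) {e : Fin (d + 1) →₀ ℕ}
    (heM : Finsupp.weight w e < M) :
    IsInitialTerm c w f e ↔ e ∈ F.support ∧ ∀ m ∈ F.support, Finsupp.weight w e ≤ Finsupp.weight w m := by
  classical
  set n := Finsupp.weight w e with hn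
  constructor
  · intro h
    -- minimality of `n` over the support
    have hfn : f ∈ weightedOrderIdeal c w n := h.mem c
    have hmin : ∀ m ∈ F.support, n ≤ Finsupp.weight w m :=
      (mem_weightedOrderIdeal_iff_of_unitRep c hgen hdim hw hFu hrem heM.le).mp hfn
    refine ⟨?_, hmin⟩
    obtain ⟨F₁, hF₁, he₁, hrem₁⟩ := h
    set F₀ := weightedHomogeneousComponent w n F with hF₀
    have hF₀hom : F₀.IsWeightedHomogeneous w n := weightedHomogeneousComponent_isWeightedHomogeneous n F
    -- `(F₁ - F₀)(c) ∈ F_{n+1}`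
    have hdiff : eval c (F₁ - F₀) ∈ weightedOrderIdeal c w (n + 1) := by
      have h3 := eval_sub_component_mem c w hmin
      have h2 : f - eval c F ∈ weightedOrderIdeal c w (n + 1) :=
        weightedOrderIdeal_antitone c w (by omega) hrem
      have : eval c (F₁ - F₀) = (f - eval c F) + eval c (F - F₀) - (f - eval c F₁) := by
        rw [map_sub, map_sub]; ring
      rw [this]
      exact Ideal.sub_mem _ (Ideal.add_mem _ h2 h3) hrem₁
    have hhom : (F₁ - F₀).IsWeightedHomogeneous w n := isWeightedHomogeneous_sub hF₁ hF₀hom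
    have hsupp : ∀ m ∈ (F₁ - F₀).support, Finsupp.weight w m = n := fun m hm =>
      hhom (mem_support_iff.mp hm)
    have hce : (F₁ - F₀).coeff e ∈ maximalIdeal R :=
      coeff_mem_maximalIdeal_of_weval_mem_weightedOrderIdeal c hgen hdim w hw hsupp hdiff e
    have hF₀e : IsUnit (F₀.coeff e) := by
      have : F₀.coeff e = F₁.coeff e + (-(F₁ - F₀).coeff e) := by rw [coeff_sub]; ring
      rw [this]
      -- a unit plus an element of `𝔪` is a unit
      by_contra hnu
      have hab : F₁.coeff e + (-(F₁ - F₀).coeff e) ∈ maximalIdeal R := (mem_maximalIdeal _).mpr hnu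
      have ha : F₁.coeff e ∈ maximalIdeal R := by
        have := Ideal.sub_mem _ hab ((maximalIdeal R).neg_mem hce)
        rwa [add_sub_cancel_right] at this
      exact (mem_maximalIdeal _).mp ha he₁
    rw [hF₀, coeff_weightedHomogeneousComponent, if_pos rfl] at hF₀e
    exact mem_support_iff.mpr hF₀e.ne_zero
  · rintro ⟨he, hmin⟩
    set F₀ := weightedHomogeneousComponent w n F with hF₀
    refine ⟨F₀, weightedHomogeneousComponent_isWeightedHomogeneous n F, ?_, ?_⟩
    · rw [hF₀, coeff_weightedHomogeneousComponent, if_pos rfl]; exact hFu e he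
    · have h3 := eval_sub_component_mem c w hmin
      have h2 : f - eval c F ∈ weightedOrderIdeal c w (n + 1) :=
        weightedOrderIdeal_antitone c w (by omega) hrem
      have : f - eval c F₀ = (f - eval c F) + eval c (F - F₀) := by rw [map_sub]; ring
      rw [this]; exact Ideal.add_mem _ h2 h3

include hgen hdim in
/-- **An initial term bounds every weighted order from above**: if `e` is a `w`-initial unit
term of `f` (`w` positive) and `f ∈ F^{(w′)}_ρ` for a positive weight `w′`, then `ρ ≤ ⟨w′, e⟩`
(the exponent `e` occurs with a unit coefficient in every fine enough unit representative of
`f`). [cite: CossartJannsenSaito2020, Remark 8.9 (2)] -/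
theorem le_weight_of_isInitialTerm_of_mem {w w' : Fin (d + 1) → ℕ} (hw : ∀ i, 0 < w i)
    (hw' : ∀ i, 0 < w' i) {f : R} {e : Fin (d + 1) →₀ ℕ} (he : IsInitialTerm c w f e) {ρ : ℕ}
    (hf : f ∈ weightedOrderIdeal c w' ρ) : ρ ≤ Finsupp.weight w' e := by
  set N := max (Finsupp.weight w e + 1) ρ with hN
  obtain ⟨F, hFu, -, hFrem⟩ := exists_unitRep c hgen f N
  have hremw : f - eval c F ∈ weightedOrderIdeal c w N :=
    pow_maximalIdeal_le_weightedOrderIdeal c _ hw hgen N hFrem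
  have hremw' : f - eval c F ∈ weightedOrderIdeal c w' N :=
    pow_maximalIdeal_le_weightedOrderIdeal c _ hw' hgen N hFrem
  have heF : e ∈ F.support :=
    ((isInitialTerm_iff_of_unitRep c hgen hdim hw hFu hremw (by omega)).mp he).1
  exact (mem_weightedOrderIdeal_iff_of_unitRep c hgen hdim hw' hFu hremw' (le_max_right _ _)).mp
    hf e heF

/-! ## The Newton point set of an ideal -/

include hgen hdim in
/-- **Non-membership is witnessed by an initial term**: if `f ∉ F^{(w)}_ρ` (`w` positive) then
`f` has a `w`-initial unit term of weight `< ρ`. [cite: CossartJannsenSaito2020, Lemma 8.3] -/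
theorem exists_isInitialTerm_of_not_mem {w : Fin (d + 1) → ℕ} (hw : ∀ i, 0 < w i) {f : R} {ρ : ℕ}
    (hfρ : f ∉ weightedOrderIdeal c w ρ) :
    ∃ e, IsInitialTerm c w f e ∧ Finsupp.weight w e < ρ := by
  classical
  obtain ⟨F, hFu, -, hFrem⟩ := exists_unitRep_weighted c hgen hw f ρ
  have hne : ¬ ∀ m ∈ F.support, ρ ≤ Finsupp.weight w m := fun h =>
    hfρ ((mem_weightedOrderIdeal_iff_of_unitRep c hgen hdim hw hFu hFrem le_rfl).mpr h)
  push Not at hne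
  have hsne : F.support.Nonempty := by
    obtain ⟨m, hm, -⟩ := hne; exact ⟨m, hm⟩
  set n := (F.support.image (Finsupp.weight w)).min' (hsne.image _) with hn
  have hnle : ∀ m ∈ F.support, n ≤ Finsupp.weight w m := fun m hm =>
    Finset.min'_le _ _ (Finset.mem_image_of_mem _ hm)
  obtain ⟨m₀, hm₀, hm₀n⟩ : ∃ m₀ ∈ F.support, Finsupp.weight w m₀ = n := by
    have := Finset.min'_mem _ (hsne.image (Finsupp.weight w))
    obtain ⟨m₀, hm₀, h⟩ := Finset.mem_image.mp this
    exact ⟨m₀, hm₀, h⟩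
  have hnρ : n < ρ := by
    obtain ⟨m, hm, hlt⟩ := hne
    exact (hnle m hm).trans_lt hlt
  refine ⟨m₀, ?_, by omega⟩
  refine (isInitialTerm_iff_of_unitRep c hgen hdim hw hFu hFrem (by omega)).mpr ⟨hm₀, ?_⟩
  intro m hm; rw [hm₀n]; exact hnle m hm

include hgen hdim in
/-- Elementwise ★: `f ∈ F^{(w)}_ρ ⟺` every `w`-initial unit term `e` of `f` has `⟨w, e⟩ ≥ ρ`
(`w` positive). [cite: CossartJannsenSaito2020, Remark 8.9 (2)] -/
theorem mem_weightedOrderIdeal_iff_forall_isInitialTerm {w : Fin (d + 1) → ℕ} (hw : ∀ i, 0 < w i)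
    (f : R) (ρ : ℕ) :
    f ∈ weightedOrderIdeal c w ρ ↔ ∀ e, IsInitialTerm c w f e → ρ ≤ Finsupp.weight w e := by
  constructor
  · intro hf e he
    exact le_weight_of_isInitialTerm_of_mem c hgen hdim hw hw he hf
  · intro h
    by_contra hf
    obtain ⟨e, he, hlt⟩ := exists_isInitialTerm_of_not_mem c hgen hdim hw hf
    have := h e he
    omega

include hgen hdim in
/-- ★ **The weighted order ideals containing `J` are determined by its Newton points, and
conversely**: for a positive weight `w`, `J ⊆ F^{(w)}_ρ ⟺ ∀ e ∈ occ c J, ρ ≤ ⟨w, e⟩`.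
[cite: CossartJannsenSaito2020, Remark 8.9 (2)] [cite: CossartPiltant2008, §4 p. 10] -/
theorem le_weightedOrderIdeal_iff_forall_occ {w : Fin (d + 1) → ℕ} (hw : ∀ i, 0 < w i) (J : Ideal R)
    (ρ : ℕ) : J ≤ weightedOrderIdeal c w ρ ↔ ∀ e ∈ occ c J, ρ ≤ Finsupp.weight w e := by
  constructor
  · rintro hJ e ⟨f, hf, w₀, hw₀, he⟩
    exact le_weight_of_isInitialTerm_of_mem c hgen hdim hw₀ hw he (hJ hf)
  · intro hall f hf
    by_contra hfρ
    obtain ⟨e, he, hlt⟩ := exists_isInitialTerm_of_not_mem c hgen hdim hw hfρ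
    have := hall e ⟨f, hf, w, hw, he⟩
    omega

include hgen hdim in
/-- Newton points of an ideal contained in `F^{(w′)}_ρ` have `w′`-weight `≥ ρ`; in particular
(weight `𝟙`) the Newton points of `J ⊆ 𝔪^μ` have degree `≥ μ`. [cite: CossartJannsenSaito2020, Ch. 7 (7.3)] -/
theorem le_degree_of_mem_occ {J : Ideal R} {μ : ℕ} (hJ : J ≤ maximalIdeal R ^ μ)
    {e : Fin (d + 1) →₀ ℕ} (he : e ∈ occ c J) : μ ≤ e.degree := by
  have hJ' : J ≤ weightedOrderIdeal c (fun _ => 1) μ := by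
    rw [weightedOrderIdeal_one_eq_pow c hgen]; exact hJ
  have := (le_weightedOrderIdeal_iff_forall_occ c hgen hdim (fun _ => Nat.one_pos) J μ).mp hJ' e he
  rw [Finsupp.degree_eq_weight_one]
  exact this

include hgen hdim in
/-- ★ for a generating set: `span S ⊆ F^{(w)}_ρ ⟺` every `w`-initial term of every generator has
weight `≥ ρ` (`w` positive) — Newton conditions may be checked on generators.
[cite: CossartJannsenSaito2020, Remark 8.9 (2)] -/
theorem span_le_weightedOrderIdeal_iff {w : Fin (d + 1) → ℕ} (hw : ∀ i, 0 < w i) (S : Set R) (ρ : ℕ) :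
    Ideal.span S ≤ weightedOrderIdeal c w ρ ↔
      ∀ f ∈ S, ∀ e, IsInitialTerm c w f e → ρ ≤ Finsupp.weight w e := by
  rw [Ideal.span_le]
  constructor
  · intro h f hf e he
    exact (mem_weightedOrderIdeal_iff_forall_isInitialTerm c hgen hdim hw f ρ).mp (h hf) e he
  · intro h f hf
    exact (mem_weightedOrderIdeal_iff_forall_isInitialTerm c hgen hdim hw f ρ).mpr (h f hf)

end Regular

end WeightedOrder

end Literature.AlgebraicGeometry.Resolution

end
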